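import Mathlib
import HarnessLib
import Summits.Ventures.LatticeQCDFlow.Exactness.SUNWilsonHMCErgodic
import Summits.Ventures.LatticeQCDFlow.Exactness.OpenBoundaryWilsonAction

/-!
# The engine's open-boundary HMC AS RUN: the plaquette-weighted `SU(N)` force is bounded and Lipschitz with the periodic constants, so the `OBC-HMC` arm converges from every start below the SAME volume-uniform trajectory-length threshold

HONEST FRAMING: exact (Metropolis-corrected) sampling algorithms for lattice gauge theory;
figures of merit are autocorrelation/cost numbers at stated couplings and volumes; no
continuum-physics claim.

Venture `LatticeQCDFlow` (cell pub-lqcd), topic `Exactness`, FANOUT row 21 (`su3-base`, third arm `OBC-HMC`: the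
engine's multi-step leapfrog HMC on the open-boundary action `β S_OBC`, `latflow.core.gauge4d` with plaquette weights —
"HB/OR/Metropolis/HMC/flow all honour it (staple sums are weighted)": the momentum increment of link `e` is built from
the staple sum in which every staple carries the weight of its plaquette).  NEW WORK of the cell over the tree
(`SUNWilsonHMCForce.lean`: the unit-weight force `sunWilsonForce`, its volume-free constants `sunWilsonForceSup`,
`sunWilsonForceLip`, the word estimates `norm_coe_plaqWord_sub_le`, `norm_coe_conjWord_sub_le`; `SUNWilsonHMCErgodic.lean`:
the threshold `sunWilsonTrajThreshold N d β` and `trajLength_threshold_arith`; `OpenBoundaryWilsonAction.lean`: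
`obcWeight`, `obcAction`, `exists_bound_smul_obcAction`, and the ABSTRACT `obc_sunLeapfrogHMCN_uniformlyErgodic` for ANY
bounded Lipschitz increment — whose hypotheses this file discharges for the increment the engine actually uses;
row 9's `SUNMultiStepLeapfrogHMCEngine`: `engine_sunLeapfrogHMCN_uniformlyErgodic` / `_invariant_unique`; the Literature
`plaquetteLoopSum` of `WilsonFlow`).  Nothing is cited as a fact; no number.

## Objects (definitions, bodies given)

* `plaqWeight w x μ ν` — the weight of the unordered plaquette at `x` in the `{μ, ν}` plane (`0` on the diagonal);
  `weightedLoopSum w V x μ` — `Ω^w_{x,μ}(V) = Σ_{ν ≠ μ} (w(x;μ,ν)·U_{upper} + w(x−ν̂;μ,ν)·U_{lower})`, the weighted version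
  of the Literature's `plaquetteLoopSum` (`weightedLoopSum_one`); `sunWeightedForce N w β U e = (β/2)·coordOf(P(Ω^w_e(U)))`
  (`sunWeightedForce_one`: `= sunWilsonForce` at `w ≡ 1`; `sunCoordι_sunWeightedForce`: its matrix is `(β/2)·P(Ω^w_e)`).

## What is proved (`G = SU(N)`, every `d`, every torus `(ℤ/L)^d`, every real `β`)

* §2 for weights with `|w| ≤ 1` (open boundaries: `obcWeight ∈ {0, ½, 1}`, `abs_obcWeight_le_one`; the PTBC defect
  `c ∈ [0, 1]` of rows 22–24 alike): **`norm_weightedLoopSum_le`** (`‖Ω^w_e‖ ≤ 2dN`), **`norm_weightedLoopSum_sub_le`**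
  (`‖Ω^w_e(U) − Ω^w_e(U')‖ ≤ 10 d N⁵ ‖U − U'‖_sup`), hence **`norm_sunWeightedForce_le`** (`≤ sunWilsonForceSup N d β`)
  and **`norm_sunWeightedForce_sub_le`** (`≤ sunWilsonForceLip N d β · ‖U − U'‖_sup`) — THE PERIODIC CONSTANTS, free
  of `L` and of the weights; `continuous_/measurable_sunWeightedForce`.
* §3 **`obcForce_sunLeapfrogHMCN_uniformlyErgodic`** — for every time direction `τ`, `n ≥ 1`, `ε > 0` with
  `nε ≤ sunWilsonTrajThreshold N d β` (THE SAME THRESHOLD AS THE PERIODIC ARM, `SUNWilsonHMCErgodic`): the engine's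
  `n`-step leapfrog HMC with the increment `−(ε/2)·sunWeightedForce N (obcWeight τ) β` and the Metropolis test on
  `β S_OBC + T` satisfies `|μ₀Kᵗ(A) − (Z⁻¹e^{−βS_OBC}·Haar^⊗)(A)| ≤ (1 − δ)^{⌊t/(k+1)⌋}` for some `k`, `δ ∈ (0, 1]`,
  EVERY initial law, every `t`, every `A`; **`obcGibbs_unique_invariant_obcForce_sunLeapfrogHMCN`**;
  **`obcForce_sunLeapfrogHMCN_uniformlyErgodic_allVolumes`** (`∃ τ₀ > 0 ∀ L …`, quantifiers in the honest order).
* §4 **`sunWeightedForce_obc_dead`** — the open-boundary force VANISHES on every dead link (`x_τ = −1`): each plaquette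
  through it has weight `0` (`plaqWeight_obc_dead_upper/_lower`, `weightedLoopSum_obc_dead`), so under the arm as run a
  dead link is rotated by its freshly drawn momentum and never kicked.

NOT CLAIMED: that `sunWeightedForce` is the exact `G`-gradient of `β·weightedWilsonAction w` (the weighted twin of row
9's `SUNWilsonForceGradient`; exactness of the chain does not need it — the Metropolis test makes EVERY measurable
increment exact, `sunLeapfrogHMCN_invariant`); any usable value of the threshold; rates uniform in `L`; the boundary
coefficient `c_G ≠ 1` (weights above `1` rescale the constants); OMF / `tau_jitter`; floating point.
-/

noncomputable section

namespace Summit.Ventures.LatticeQCDFlow.Exactness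

open MeasureTheory ProbabilityTheory ProbabilityTheory.Kernel Set Function
open Literature.MathematicalPhysics.QuantumFieldTheory
open scoped ENNReal Matrix Matrix.Norms.Operator NNReal

set_option backward.isDefEq.respectTransparency false

/-! ## §1 Plaquette weights per (site, pair of directions); the weighted loop sum -/

section Weights

variable {d L N : ℕ}

/-- The weight of the unordered plaquette at `x` in the `{μ, ν}` plane (the tree's `Scoring.plane μ ν`, smaller
direction first), read from a weight on `Plaquette d L`; `0` when `μ = ν`. -/
def plaqWeight (w : Plaquette d L → ℝ) (x : Site d L) (μ ν : Fin d) : ℝ :=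
  if h : μ = ν then 0 else w (x, Scoring.plane μ ν h)

/-- Unit weights read `1` off the diagonal. -/
theorem plaqWeight_one {x : Site d L} {μ ν : Fin d} (h : ν ≠ μ) :
    plaqWeight (fun _ : Plaquette d L => (1 : ℝ)) x μ ν = 1 := by
  unfold plaqWeight; rw [dif_neg (Ne.symm h)]

/-- `|plaqWeight w| ≤ 1` when `|w| ≤ 1`. -/
theorem abs_plaqWeight_le_one {w : Plaquette d L → ℝ} (hw : ∀ p, |w p| ≤ 1) (x : Site d L) (μ ν : Fin d) :
    |plaqWeight w x μ ν| ≤ 1 := by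
  unfold plaqWeight; split_ifs; · simp
  exact hw _

/-- **The plaquette-weighted loop sum** `Ω^w_{x,μ}(V) = Σ_{ν ≠ μ} (w(x;μ,ν) · U_upper + w(x − ν̂;μ,ν) · U_lower)`:
each of the `2(d−1)` plaquette holonomies through the link `(x, μ)` (oriented to start with `V(x,μ)`, as in the
Literature's `plaquetteLoopSum`) carries the weight of its plaquette. -/
def weightedLoopSum (w : Plaquette d L → ℝ) (V : GaugeConfig d L (Matrix.specialUnitaryGroup (Fin N) ℂ))
    (x : Site d L) (μ : Fin d) : Matrix (Fin N) (Fin N) ℂ :=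
  ∑ ν : Fin d, if ν = μ then (0 : Matrix (Fin N) (Fin N) ℂ) else
    (plaqWeight w x μ ν • (((plaquetteHolonomy V x μ ν : Matrix.specialUnitaryGroup (Fin N) ℂ)) : Matrix (Fin N) (Fin N) ℂ) +
      plaqWeight w (x - Pi.single ν 1) μ ν •
        (((V (x - Pi.single ν 1, ν))⁻¹ * plaquetteHolonomy V (x - Pi.single ν 1) ν μ * V (x - Pi.single ν 1, ν) :
          Matrix.specialUnitaryGroup (Fin N) ℂ) : Matrix (Fin N) (Fin N) ℂ))

/-- **Unit weights give the Literature's loop sum**: `Ω^1 = Ω`. -/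
theorem weightedLoopSum_one (V : GaugeConfig d L (Matrix.specialUnitaryGroup (Fin N) ℂ)) (x : Site d L) (μ : Fin d) :
    weightedLoopSum (fun _ : Plaquette d L => (1 : ℝ)) V x μ = plaquetteLoopSum V x μ := by
  unfold weightedLoopSum plaquetteLoopSum
  refine Finset.sum_congr rfl fun ν _ => ?_
  by_cases h : ν = μ
  · rw [if_pos h, if_pos h]
  · rw [if_neg h, if_neg h, plaqWeight_one h, plaqWeight_one h, one_smul, one_smul]

/-- `‖Ω^w_{x,μ}(V)‖ ≤ 2dN` for `|w| ≤ 1` (at most `2d` special unitary matrices with coefficients of modulus `≤ 1`). -/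
theorem norm_weightedLoopSum_le {w : Plaquette d L → ℝ} (hw : ∀ p, |w p| ≤ 1)
    (V : GaugeConfig d L (Matrix.specialUnitaryGroup (Fin N) ℂ)) (x : Site d L) (μ : Fin d) :
    ‖weightedLoopSum w V x μ‖ ≤ 2 * d * N := by
  have hN0 : (0 : ℝ) ≤ N := Nat.cast_nonneg N
  have hterm : ∀ (a : ℝ) (g : Matrix.specialUnitaryGroup (Fin N) ℂ), |a| ≤ 1 →
      ‖a • ((g : Matrix.specialUnitaryGroup (Fin N) ℂ) : Matrix (Fin N) (Fin N) ℂ)‖ ≤ N := fun a g ha => by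
    rw [norm_smul, Real.norm_eq_abs]
    exact (mul_le_mul ha (norm_coe_su_le g) (norm_nonneg _) zero_le_one).trans_eq (one_mul _)
  unfold weightedLoopSum
  refine (norm_sum_le _ _).trans ((Finset.sum_le_sum (g := fun _ : Fin d => (N : ℝ) + N) fun ν _ => ?_).trans
    (le_of_eq (by simp [Finset.sum_const, Finset.card_univ]; ring)))
  split_ifs
  · rw [norm_zero]; positivity
  · exact (norm_add_le _ _).trans (add_le_add (hterm _ _ (abs_plaqWeight_le_one hw _ _ _))
      (hterm _ _ (abs_plaqWeight_le_one hw _ _ _)))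

/-- **`‖Ω^w_{x,μ}(U) − Ω^w_{x,μ}(U')‖ ≤ 10 d N⁵ · ‖U − U'‖_sup`** for `|w| ≤ 1` — the periodic Lipschitz constant. -/
theorem norm_weightedLoopSum_sub_le [NeZero N] [NeZero L] {w : Plaquette d L → ℝ} (hw : ∀ p, |w p| ≤ 1)
    (U U' : GaugeConfig d L (Matrix.specialUnitaryGroup (Fin N) ℂ)) (x : Site d L) (μ : Fin d) :
    ‖weightedLoopSum w U x μ - weightedLoopSum w U' x μ‖ ≤ 10 * d * N ^ 5 * ‖coeConfig U - coeConfig U'‖ := by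
  have hN : (1 : ℝ) ≤ N := by exact_mod_cast Nat.one_le_iff_ne_zero.2 (NeZero.ne N)
  have hδ0 : 0 ≤ ‖coeConfig U - coeConfig U'‖ := norm_nonneg _
  have hδ := norm_coe_link_sub_le U U'
  have hplaq : ∀ (y : Site d L) (i j : Fin d),
      ‖((plaquetteHolonomy U y i j : Matrix.specialUnitaryGroup (Fin N) ℂ) : Matrix (Fin N) (Fin N) ℂ)
          - ↑(plaquetteHolonomy U' y i j : Matrix.specialUnitaryGroup (Fin N) ℂ)‖
        ≤ 4 * N ^ 3 * ‖coeConfig U - coeConfig U'‖ := fun y i j => by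
    unfold plaquetteHolonomy
    exact norm_coe_plaqWord_sub_le (hδ _) (hδ _) (hδ _) (hδ _)
  -- a coefficient of modulus `≤ 1` does not enlarge a difference
  have hsmul : ∀ (a : ℝ) (A A' : Matrix (Fin N) (Fin N) ℂ) (c : ℝ), |a| ≤ 1 → ‖A - A'‖ ≤ c →
      ‖a • A - a • A'‖ ≤ c := fun a A A' c ha h => by
    rw [← smul_sub, norm_smul, Real.norm_eq_abs]
    exact (mul_le_mul_of_nonneg_right ha (norm_nonneg _)).trans (by rw [one_mul]; exact h)
  unfold weightedLoopSum
  rw [← Finset.sum_sub_distrib]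
  refine (norm_sum_le _ _).trans ((Finset.sum_le_sum (g := fun _ : Fin d => 10 * N ^ 5 * ‖coeConfig U - coeConfig U'‖)
    fun ν _ => ?_).trans (le_of_eq (by simp [Finset.sum_const, Finset.card_univ]; ring)))
  split_ifs
  · simp only [sub_zero, norm_zero]; positivity
  · have hA := hsmul (plaqWeight w x μ ν) _ _ _ (abs_plaqWeight_le_one hw _ _ _) (hplaq x μ ν)
    have hB := hsmul (plaqWeight w (x - Pi.single ν 1) μ ν) _ _ _ (abs_plaqWeight_le_one hw _ _ _)
      (norm_coe_conjWord_sub_le (hδ (x - Pi.single ν 1, ν)) (hplaq (x - Pi.single ν 1) ν μ))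
    have h35 : (N : ℝ) ^ 3 ≤ N ^ 5 := pow_le_pow_right₀ hN (by norm_num)
    rw [add_sub_add_comm]
    calc _ ≤ 4 * N ^ 3 * ‖coeConfig U - coeConfig U'‖ + 6 * N ^ 5 * ‖coeConfig U - coeConfig U'‖ :=
          (norm_add_le _ _).trans (add_le_add hA hB)
      _ ≤ 10 * N ^ 5 * ‖coeConfig U - coeConfig U'‖ := by nlinarith [mul_le_mul_of_nonneg_right h35 hδ0]

/-- `U ↦ Ω^w_{x,μ}(U)` is continuous. -/
theorem continuous_weightedLoopSum (w : Plaquette d L → ℝ) (x : Site d L) (μ : Fin d) :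
    Continuous fun U : GaugeConfig d L (Matrix.specialUnitaryGroup (Fin N) ℂ) => weightedLoopSum w U x μ := by
  unfold weightedLoopSum
  refine continuous_finsetSum _ fun ν _ => ?_
  by_cases h : ν = μ
  · simp only [h, if_true]; exact continuous_const
  · simp only [h, if_false]
    refine ((continuous_subtype_val.comp
      (Literature.MathematicalPhysics.QuantumLattice.continuous_plaquetteHolonomy x μ ν)).const_smul
        (plaqWeight w x μ ν)).add
      ((continuous_subtype_val.comp ?_).const_smul (plaqWeight w (x - Pi.single ν 1) μ ν))
    exact (((continuous_apply _).inv).mul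
      (Literature.MathematicalPhysics.QuantumLattice.continuous_plaquetteHolonomy _ ν μ)).mul (continuous_apply _)

/-- The open-boundary weights take the values `0, ½, 1`: `|obcWeight τ p| ≤ 1`. -/
theorem abs_obcWeight_le_one (τ : Fin d) (p : Plaquette d L) : |obcWeight τ p| ≤ 1 := by
  unfold obcWeight
  split_ifs <;> norm_num

end Weights

/-! ## §2 The engine's force for a plaquette-weighted action: the periodic constants -/

section Force

variable (N : ℕ) {d L : ℕ}

/-- **The engine's HMC force for a plaquette-weighted Wilson action** in the engine's coordinates of `𝔰𝔲(N)`: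
`F^w_e(U) = (β/2) · coordOf (P(Ω^w_e(U)))` (weighted staples; at `w ≡ 1` the force `sunWilsonForce` of record). -/
def sunWeightedForce (w : Plaquette d L → ℝ) (β : ℝ) (U : GaugeConfig d L (Matrix.specialUnitaryGroup (Fin N) ℂ))
    (e : Edge d L) : SUNCoords N :=
  (β / 2) • coordOf (sunCoordι N) (sunCoordι_injective N) (suProj (weightedLoopSum w U e.1 e.2))

/-- **Dictionary**: unit weights give the periodic force of record, `F^1 = sunWilsonForce`. -/
theorem sunWeightedForce_one (β : ℝ) :
    (sunWeightedForce N (fun _ : Plaquette d L => (1 : ℝ)) β :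
      GaugeConfig d L (Matrix.specialUnitaryGroup (Fin N) ℂ) → Edge d L → SUNCoords N) = sunWilsonForce N β := by
  funext U e
  rw [sunWeightedForce, sunWilsonForce, weightedLoopSum_one]

/-- **Dictionary**: read back in the matrix algebra, the weighted force IS the matrix `(β/2)·P(Ω^w_e(U))`. -/
theorem sunCoordι_sunWeightedForce (w : Plaquette d L → ℝ) (β : ℝ)
    (U : GaugeConfig d L (Matrix.specialUnitaryGroup (Fin N) ℂ)) (e : Edge d L) :
    sunCoordι N (sunWeightedForce N w β U e) = (β / 2) • suProj (weightedLoopSum w U e.1 e.2) := by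
  obtain ⟨c, hc⟩ := LinearMap.mem_range.1 (sunCoordι_range N (suProj (weightedLoopSum w U e.1 e.2))
    (conjTranspose_suProj _) (trace_suProj _))
  rw [sunWeightedForce, map_smul, ← hc, coordOf_apply]

/-- The weighted force is continuous in the configuration. -/
theorem continuous_sunWeightedForce (w : Plaquette d L → ℝ) (β : ℝ) :
    Continuous (sunWeightedForce N w β : GaugeConfig d L (Matrix.specialUnitaryGroup (Fin N) ℂ) → Edge d L → SUNCoords N) := by
  refine continuous_pi fun e => ?_
  exact (((continuous_coordOf (sunCoordι N) (sunCoordι_injective N)).comp continuous_suProj).comp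
    (continuous_weightedLoopSum w e.1 e.2)).const_smul (β / 2)

/-- The weighted force is measurable (hypothesis `hg` of the kernel theorems). -/
theorem measurable_sunWeightedForce [NeZero L] (w : Plaquette d L → ℝ) (β : ℝ) :
    Measurable (sunWeightedForce N w β : GaugeConfig d L (Matrix.specialUnitaryGroup (Fin N) ℂ) → Edge d L → SUNCoords N) :=
  measurable_pi_lambda _ fun e => ((((continuous_coordOf (sunCoordι N) (sunCoordι_injective N)).comp
    continuous_suProj).comp (continuous_weightedLoopSum w e.1 e.2)).const_smul (β / 2)).measurable

/-- **`‖F^w_e(U)‖ ≤ sunWilsonForceSup N d β`** for `|w| ≤ 1`: the periodic sup bound, on every torus. -/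
theorem norm_sunWeightedForce_le [NeZero N] {w : Plaquette d L → ℝ} (hw : ∀ p, |w p| ≤ 1) (β : ℝ)
    (U : GaugeConfig d L (Matrix.specialUnitaryGroup (Fin N) ℂ)) (e : Edge d L) :
    ‖sunWeightedForce N w β U e‖ ≤ sunWilsonForceSup N d β := by
  have hκ := sunCoordNorm_nonneg N
  have hN0 : (0 : ℝ) ≤ N := Nat.cast_nonneg N
  have h1 : ‖coordOf (sunCoordι N) (sunCoordι_injective N) (suProj (weightedLoopSum w U e.1 e.2))‖
      ≤ sunCoordNorm N * ((N + 1) * (2 * d * N)) :=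
    (norm_coordOf_le N _).trans (mul_le_mul_of_nonneg_left
      ((norm_suProj_le_linfty _).trans (mul_le_mul_of_nonneg_left (norm_weightedLoopSum_le hw U e.1 e.2) (by positivity)))
      hκ)
  rw [sunWeightedForce, norm_smul, Real.norm_eq_abs, abs_div, abs_two, sunWilsonForceSup]
  calc |β| / 2 * ‖coordOf (sunCoordι N) (sunCoordι_injective N) (suProj (weightedLoopSum w U e.1 e.2))‖
      ≤ |β| / 2 * (sunCoordNorm N * ((N + 1) * (2 * d * N))) := mul_le_mul_of_nonneg_left h1 (by positivity)
    _ = |β| * sunCoordNorm N * (N + 1) * d * N := by ring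

/-- **`‖F^w(U) − F^w(U')‖_sup ≤ sunWilsonForceLip N d β · ‖U − U'‖_sup`** for `|w| ≤ 1`: the periodic Lipschitz
constant, on every torus. -/
theorem norm_sunWeightedForce_sub_le [NeZero N] [NeZero L] {w : Plaquette d L → ℝ} (hw : ∀ p, |w p| ≤ 1) (β : ℝ)
    (U U' : GaugeConfig d L (Matrix.specialUnitaryGroup (Fin N) ℂ)) :
    ‖sunWeightedForce N w β U - sunWeightedForce N w β U'‖ ≤ sunWilsonForceLip N d β * ‖coeConfig U - coeConfig U'‖ := by
  have hκ := sunCoordNorm_nonneg N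
  have hN0 : (0 : ℝ) ≤ N := Nat.cast_nonneg N
  refine (pi_norm_le_iff_of_nonneg (mul_nonneg (sunWilsonForceLip_nonneg N d β) (norm_nonneg _))).2 fun e => ?_
  have hsub : (sunWeightedForce N w β U - sunWeightedForce N w β U') e =
      (β / 2) • coordOf (sunCoordι N) (sunCoordι_injective N)
        (suProj (weightedLoopSum w U e.1 e.2 - weightedLoopSum w U' e.1 e.2)) := by
    rw [Luscher2010.suProj_sub, map_sub, smul_sub]; rfl
  have h1 : ‖coordOf (sunCoordι N) (sunCoordι_injective N)
        (suProj (weightedLoopSum w U e.1 e.2 - weightedLoopSum w U' e.1 e.2))‖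
      ≤ sunCoordNorm N * ((N + 1) * (10 * d * N ^ 5 * ‖coeConfig U - coeConfig U'‖)) :=
    (norm_coordOf_le N _).trans (mul_le_mul_of_nonneg_left
      ((norm_suProj_le_linfty _).trans (mul_le_mul_of_nonneg_left (norm_weightedLoopSum_sub_le hw U U' e.1 e.2)
        (by positivity))) hκ)
  rw [hsub, norm_smul, Real.norm_eq_abs, abs_div, abs_two, sunWilsonForceLip]
  calc |β| / 2 * ‖coordOf (sunCoordι N) (sunCoordι_injective N)
          (suProj (weightedLoopSum w U e.1 e.2 - weightedLoopSum w U' e.1 e.2))‖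
      ≤ |β| / 2 * (sunCoordNorm N * ((N + 1) * (10 * d * N ^ 5 * ‖coeConfig U - coeConfig U'‖))) :=
        mul_le_mul_of_nonneg_left h1 (by positivity)
    _ = 5 * |β| * sunCoordNorm N * (N + 1) * d * N ^ 5 * ‖coeConfig U - coeConfig U'‖ := by ring

end Force

/-! ## §3 The `OBC-HMC` arm as run: convergence below the periodic volume-uniform threshold -/

section OBC

variable (N : ℕ) [NeZero N] (d : ℕ) (β : ℝ)

/-- **THE ENGINE'S `n`-STEP LEAPFROG HMC WITH ITS OWN OPEN-BOUNDARY FORCE CONVERGES TO THE OPEN-BOUNDARY GIBBS LAW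
FROM EVERY START**, on every torus `(ℤ/L)^d`, every time direction `τ`, every `n ≥ 1`, `ε > 0` with
`nε ≤ sunWilsonTrajThreshold N d β` — the threshold of the periodic arm: there are `k` and `δ ∈ (0, 1]` with
`|μ₀Kᵗ(A) − (Z⁻¹e^{−βS_OBC}·Haar^⊗)(A)| ≤ (1 − δ)^{⌊t/(k+1)⌋}` for EVERY initial law `μ₀`, every `t`, every `A`. -/
theorem obcForce_sunLeapfrogHMCN_uniformlyErgodic (τ : Fin d) (L : ℕ) [NeZero L] {nstep : ℕ} {ε : ℝ}
    (hn : 1 ≤ nstep) (hε : 0 < ε) (hτ : nstep * ε ≤ sunWilsonTrajThreshold N d β) :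
    ∃ k : ℕ, ∃ δ : ℝ, 0 < δ ∧ δ ≤ 1 ∧
      ∀ (μ₀ : Measure (GaugeConfig d L (Matrix.specialUnitaryGroup (Fin N) ℂ))) [IsProbabilityMeasure μ₀]
        (t : ℕ) (A : Set (GaugeConfig d L (Matrix.specialUnitaryGroup (Fin N) ℂ))),
        |((fun m : Measure (GaugeConfig d L (Matrix.specialUnitaryGroup (Fin N) ℂ)) =>
              m.bind (sunLeapfrogHMCN (sunCoordι N) (sunCoordι_skew N) ε (Measure.addHaar : Measure (SUNCoords N))
                (sunKinetic N)
                (measurable_halfKick_sun N (measurable_sunWeightedForce N (d := d) (L := L) (obcWeight τ) β) ε)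
                (fun U => β * obcAction (suRep N) τ U) nstep))^[t] μ₀).real A
            - (gibbsProbability (Measure.pi fun _ : Edge d L => haarProbability (Matrix.specialUnitaryGroup (Fin N) ℂ))
                (fun U => Real.exp (-(β * obcAction (suRep N) τ U)))).real A| ≤ (1 - δ) ^ (t / (k + 1)) := by
  obtain ⟨h1, h2, h3⟩ := trajLength_threshold_arith (sunShortTrajThreshold_pos (sunCoordι N) (sunCoordι_injective N))
    (sunWilsonForceSup_nonneg N d β) (sunWilsonForceLip_nonneg N d β) hn hε
    (rfl : sunWilsonTrajThreshold N d β = _) hτ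
  obtain ⟨s, hs⟩ := exists_bound_smul_obcAction (d := d) (L := L) (suRep N) continuous_suRep τ β
  refine engine_sunLeapfrogHMCN_uniformlyErgodic N hε hn
    (measurable_halfKick_sun N (measurable_sunWeightedForce N (obcWeight τ) β) ε)
    (b := ε / 2 * sunWilsonForceSup N d β) (Kg := ε / 2 * sunWilsonForceLip N d β)
    (mul_nonneg (by positivity) (sunWilsonForceSup_nonneg N d β)) (fun U l => ?_)
    (mul_nonneg (by positivity) (sunWilsonForceLip_nonneg N d β)) (fun U U' => ?_)
    ((continuous_obcAction (suRep N) continuous_suRep τ).measurable.const_mul β) hs h1 h2 h3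
  · rw [Pi.smul_apply, norm_smul, Real.norm_eq_abs, abs_neg, abs_of_pos (by positivity)]
    exact mul_le_mul_of_nonneg_left (norm_sunWeightedForce_le N (abs_obcWeight_le_one τ) β U l) (by positivity)
  · have hsub : (-(ε / 2)) • sunWeightedForce N (obcWeight τ) β U - (-(ε / 2)) • sunWeightedForce N (obcWeight τ) β U' =
        (-(ε / 2)) • (sunWeightedForce N (obcWeight τ) β U - sunWeightedForce N (obcWeight τ) β U') := by rw [smul_sub]
    rw [hsub, norm_smul, Real.norm_eq_abs, abs_neg, abs_of_pos (by positivity), mul_assoc]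
    exact mul_le_mul_of_nonneg_left (norm_sunWeightedForce_sub_le N (abs_obcWeight_le_one τ) β U U') (by positivity)

/-- **The open-boundary Gibbs law is the unique invariant probability law** of the engine's `n`-step leapfrog HMC with
its own open-boundary force, under the same volume-independent trajectory-length condition. -/
theorem obcGibbs_unique_invariant_obcForce_sunLeapfrogHMCN (τ : Fin d) (L : ℕ) [NeZero L] {nstep : ℕ} {ε : ℝ}
    (hn : 1 ≤ nstep) (hε : 0 < ε) (hτ : nstep * ε ≤ sunWilsonTrajThreshold N d β)
    {π' : Measure (GaugeConfig d L (Matrix.specialUnitaryGroup (Fin N) ℂ))} [IsProbabilityMeasure π']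
    (hπ' : Invariant (sunLeapfrogHMCN (sunCoordι N) (sunCoordι_skew N) ε (Measure.addHaar : Measure (SUNCoords N))
      (sunKinetic N) (measurable_halfKick_sun N (measurable_sunWeightedForce N (d := d) (L := L) (obcWeight τ) β) ε)
      (fun U => β * obcAction (suRep N) τ U) nstep) π') :
    π' = gibbsProbability (Measure.pi fun _ : Edge d L => haarProbability (Matrix.specialUnitaryGroup (Fin N) ℂ))
      (fun U => Real.exp (-(β * obcAction (suRep N) τ U))) := by
  obtain ⟨h1, h2, h3⟩ := trajLength_threshold_arith (sunShortTrajThreshold_pos (sunCoordι N) (sunCoordι_injective N))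
    (sunWilsonForceSup_nonneg N d β) (sunWilsonForceLip_nonneg N d β) hn hε
    (rfl : sunWilsonTrajThreshold N d β = _) hτ
  obtain ⟨s, hs⟩ := exists_bound_smul_obcAction (d := d) (L := L) (suRep N) continuous_suRep τ β
  refine engine_sunLeapfrogHMCN_invariant_unique N hε hn
    (measurable_halfKick_sun N (measurable_sunWeightedForce N (obcWeight τ) β) ε)
    (b := ε / 2 * sunWilsonForceSup N d β) (Kg := ε / 2 * sunWilsonForceLip N d β)
    (mul_nonneg (by positivity) (sunWilsonForceSup_nonneg N d β)) (fun U l => ?_)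
    (mul_nonneg (by positivity) (sunWilsonForceLip_nonneg N d β)) (fun U U' => ?_)
    ((continuous_obcAction (suRep N) continuous_suRep τ).measurable.const_mul β) hs h1 h2 h3 hπ'
  · rw [Pi.smul_apply, norm_smul, Real.norm_eq_abs, abs_neg, abs_of_pos (by positivity)]
    exact mul_le_mul_of_nonneg_left (norm_sunWeightedForce_le N (abs_obcWeight_le_one τ) β U l) (by positivity)
  · have hsub : (-(ε / 2)) • sunWeightedForce N (obcWeight τ) β U - (-(ε / 2)) • sunWeightedForce N (obcWeight τ) β U' =
        (-(ε / 2)) • (sunWeightedForce N (obcWeight τ) β U - sunWeightedForce N (obcWeight τ) β U') := by rw [smul_sub]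
    rw [hsub, norm_smul, Real.norm_eq_abs, abs_neg, abs_of_pos (by positivity), mul_assoc]
    exact mul_le_mul_of_nonneg_left (norm_sunWeightedForce_sub_le N (abs_obcWeight_le_one τ) β U U') (by positivity)

/-- **ONE THRESHOLD FOR ALL LATTICE SIZES, SHARED WITH THE PERIODIC ARM**: `∃ τ₀ > 0` (namely `sunWilsonTrajThreshold
N d β`) such that on EVERY torus, for every time direction, `n ≥ 1`, `ε > 0` with `nε ≤ τ₀`, the engine's `n`-step
leapfrog HMC with its own open-boundary force converges to the open-boundary Gibbs law from every initial law. -/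
theorem obcForce_sunLeapfrogHMCN_uniformlyErgodic_allVolumes :
    ∃ τ₀ : ℝ, 0 < τ₀ ∧ ∀ (L : ℕ) [NeZero L] (τ : Fin d) (nstep : ℕ) (ε : ℝ), 1 ≤ nstep → 0 < ε → nstep * ε ≤ τ₀ →
      ∃ k : ℕ, ∃ δ : ℝ, 0 < δ ∧ δ ≤ 1 ∧
        ∀ (μ₀ : Measure (GaugeConfig d L (Matrix.specialUnitaryGroup (Fin N) ℂ))) [IsProbabilityMeasure μ₀]
          (t : ℕ) (A : Set (GaugeConfig d L (Matrix.specialUnitaryGroup (Fin N) ℂ))),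
          |((fun m : Measure (GaugeConfig d L (Matrix.specialUnitaryGroup (Fin N) ℂ)) =>
                m.bind (sunLeapfrogHMCN (sunCoordι N) (sunCoordι_skew N) ε (Measure.addHaar : Measure (SUNCoords N))
                  (sunKinetic N)
                  (measurable_halfKick_sun N (measurable_sunWeightedForce N (d := d) (L := L) (obcWeight τ) β) ε)
                  (fun U => β * obcAction (suRep N) τ U) nstep))^[t] μ₀).real A
              - (gibbsProbability (Measure.pi fun _ : Edge d L => haarProbability (Matrix.specialUnitaryGroup (Fin N) ℂ))
                  (fun U => Real.exp (-(β * obcAction (suRep N) τ U)))).real A| ≤ (1 - δ) ^ (t / (k + 1)) :=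
  ⟨sunWilsonTrajThreshold N d β, sunWilsonTrajThreshold_pos N d β,
    fun L _ τ _ _ hn hε hτ => obcForce_sunLeapfrogHMCN_uniformlyErgodic N d β τ L hn hε hτ⟩

end OBC

/-! ## §4 Dead links feel no force: under the engine's open-boundary HMC they rotate freely -/

section Dead

variable (N : ℕ) {d L : ℕ}

/-- A dead link `(x, τ)` (`x_τ = −1`) lies on the boundary of the upper plaquette through it in every plane `{τ, ν}`,
whose open-boundary weight is therefore `0`. -/
theorem plaqWeight_obc_dead_upper {τ ν : Fin d} {x : Site d L} (hx : x τ = -1) (hν : ν ≠ τ) :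
    plaqWeight (obcWeight (L := L) τ) x τ ν = 0 := by
  unfold plaqWeight
  rw [dif_neg (Ne.symm hν)]
  refine obcWeight_eq_zero_of_dead_mem τ (e := (x, τ)) rfl hx ?_
  rw [mem_plaquetteEdges]
  unfold Scoring.plane
  by_cases hlt : τ < ν
  · rw [dif_pos hlt]; exact Or.inl rfl
  · rw [dif_neg hlt]; exact Or.inr (Or.inr (Or.inr rfl))

/-- … and on the boundary of the lower plaquette through it (based at `x − ν̂`), weight `0` as well. -/
theorem plaqWeight_obc_dead_lower {τ ν : Fin d} {x : Site d L} (hx : x τ = -1) (hν : ν ≠ τ) :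
    plaqWeight (obcWeight (L := L) τ) (x - Pi.single ν 1) τ ν = 0 := by
  unfold plaqWeight
  rw [dif_neg (Ne.symm hν)]
  have hshift : (x - Pi.single ν 1 : Site d L).shift ν = x := by rw [Site.shift, sub_add_cancel]
  refine obcWeight_eq_zero_of_dead_mem τ (e := (x, τ)) rfl hx ?_
  rw [mem_plaquetteEdges]
  unfold Scoring.plane
  by_cases hlt : τ < ν
  · rw [dif_pos hlt]; exact Or.inr (Or.inr (Or.inl (by rw [hshift])))
  · rw [dif_neg hlt]; exact Or.inr (Or.inl (by rw [hshift]))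

/-- **The open-boundary loop sum of a dead link vanishes**: every plaquette through it has weight `0`. -/
theorem weightedLoopSum_obc_dead (τ : Fin d) (V : GaugeConfig d L (Matrix.specialUnitaryGroup (Fin N) ℂ)) {x : Site d L}
    (hx : x τ = -1) : weightedLoopSum (obcWeight τ) V x τ = 0 := by
  unfold weightedLoopSum
  refine Finset.sum_eq_zero fun ν _ => ?_
  by_cases hν : ν = τ
  · rw [if_pos hν]
  · rw [if_neg hν, plaqWeight_obc_dead_upper hx hν, plaqWeight_obc_dead_lower hx hν, zero_smul, zero_smul, add_zero]

/-- **THE ENGINE'S OPEN-BOUNDARY FORCE VANISHES ON THE DEAD LINKS**: `F^{obc}_{(x,τ)}(U) = 0` whenever `x_τ = −1`.  Under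
the `OBC-HMC` arm as run a dead link's momentum is never kicked: the link is rotated by `exp` of its freshly drawn
momentum along each trajectory, independently of all other links (consistent with `obcGibbs_inter_deadLink_eq`: dead
links are Haar spectators of the target). -/
theorem sunWeightedForce_obc_dead (τ : Fin d) (β : ℝ) (U : GaugeConfig d L (Matrix.specialUnitaryGroup (Fin N) ℂ))
    {x : Site d L} (hx : x τ = -1) : sunWeightedForce N (obcWeight τ) β U (x, τ) = 0 := by
  rw [sunWeightedForce, weightedLoopSum_obc_dead N τ U hx, suProj_zero, LinearMap.map_zero, smul_zero]

end Dead

end Summit.Ventures.LatticeQCDFlow.Exactness
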